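import Literature.Barriers.PneNP.TSPExtensionComplexityRothvossGood
import Literature.Barriers.PneNP.TSPExtensionComplexityRothvossBridge
import Mathlib.Analysis.SpecialFunctions.Pow.Real
import HarnessLib

/-!
# Rothvoß's Lemma 7 assembled from its three parts; `Rothvoss2017_tsp` from the bad-pair bound

Support file for the discharge of `Literature.Barriers.PneNP.Rothvoss2017_tsp`. Rothvoß's
inequality `(*)` (§3.3, PDF p. 9) splits `μ_3(R)` into the contributions of GOOD, SMALL and BAD
pairs `(T, H)`; here the same for the sample space: `|Ω_3 ∩ R| = good + small + bad` with

* the good part bounded in `…RothvossGood.lean` (`card_OmegaR_good_mul_le`),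
* the small part `≤ θ |Ω_3|` pointwise (`card_OmegaR_small_le`, §3.3 "the estimate that is easy"),
* the bad part `≤ ε |Ω_3 ∩ R|` PROVIDED each `(U, M)`-fibre of `Ω_3` has at most an `ε`-fraction of
  bad partitions (`card_OmegaR_bad_le`; the fibre statement is Rothvoß's Lemma 13 =
  Lemmas 14 + 15, the re-randomisation arguments of §3.6).

`lemma7_of_bad_fibre_bound` combines them into
`|Ω_3 ∩ R|/|Ω_3| ≤ (400/k²) |Ω_k ∩ R|/|Ω_k| + (8/7) θ` (for `ε = 1/8`, `k ≥ 10`), and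
`rothvoss2017_tsp_of_bad_fibre_bound` feeds this into `rothvoss2017_tsp_of_sampler_bound`: the
named fact follows from the bad-fibre bound (Lemma 13) alone.

Sources: [Rothvoss2017] §3.3 (PDF p. 9: `(*)` and the small pairs), §3.6 (PDF p. 11: the
exchange "`(U,M)` first, then `T ∼ 𝒫(U,M)`", Lemma 13), Lemma 7 (PDF p. 8).
-/

noncomputable section

namespace Literature.Barriers.PneNP

open Finset Filter Literature.Combinatorics.SimpleGraph.CycleSpace Lbl

variable {n m k : ℕ}

/-! ### The small part -/

/-- **The small pairs contribute at most `θ |Ω_3|`** ("each time that SMALL(T,H) = 1, we have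
by definition `p^ex_M p^ex_U ≤ 2^{-δm}`"). [cite: Rothvoss2017, §3.3 (PDF p. 9)] -/
theorem card_OmegaR_small_le (t : ℕ) (X : Finset (Finset (Fin n))) (Y : Finset (Finset (Sym2 (Fin n))))
    {θ : ℝ} (hθ : 0 ≤ θ) :
    (((OmegaR n m k t 3 X Y).filter fun ω => SmallΩ X Y ω.1 t (ω.2.2.filter (IsCD ω.1)) θ).card : ℝ) ≤
      θ * (Omega n m k t 3).card := by
  classical
  rw [card_OmegaR_filter_eq_sum t 3 X Y (fun lab H => SmallΩ X Y lab t H θ), card_Omega_eq_sum]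
  push_cast
  rw [mul_sum]
  refine sum_le_sum fun lab _ => ?_
  rw [mul_sum, sum_filter]
  refine sum_le_sum fun H _ => ?_
  have hA : ((X ∩ Uext lab t H).card : ℝ) ≤ (Uext lab t H).card := by
    exact_mod_cast card_le_card inter_subset_right
  have hB : ((Y ∩ Mext lab H).card : ℝ) ≤ (Mext lab H).card := by
    exact_mod_cast card_le_card inter_subset_right
  have hA0 : (0 : ℝ) ≤ (X ∩ Uext lab t H).card := Nat.cast_nonneg _
  have hB0 : (0 : ℝ) ≤ (Y ∩ Mext lab H).card := Nat.cast_nonneg _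
  have hu0 : (0 : ℝ) ≤ (Uext lab t H).card := Nat.cast_nonneg _
  have hw0 : (0 : ℝ) ≤ (Mext lab H).card := Nat.cast_nonneg _
  split_ifs with hsmall
  · rw [termN]; push_cast
    rcases hsmall with h | h
    · calc ((X ∩ Uext lab t H).card : ℝ) * (Y ∩ Mext lab H).card
          ≤ (Uext lab t H).card * (θ * (Mext lab H).card) := mul_le_mul hA h hB0 hu0
        _ = θ * ((Uext lab t H).card * (Mext lab H).card) := by ring
    · calc ((X ∩ Uext lab t H).card : ℝ) * (Y ∩ Mext lab H).card
          ≤ (θ * (Uext lab t H).card) * (Mext lab H).card := mul_le_mul h hB hB0 (by positivity)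
        _ = θ * ((Uext lab t H).card * (Mext lab H).card) := by ring
  · positivity

/-! ### The bad part from the fibre bound (Lemma 13) -/

/-- **The exchange "`(U, M)` first, then `T`"**: if every `(U, M)`-fibre of `Ω_3` contains at most an
`ε`-fraction of outcomes whose pair `(T, H)` has property `B`, then the outcomes in any rectangle
with property `B` are at most an `ε`-fraction of the rectangle.
[cite: Rothvoss2017, §3.6 (PDF p. 11: "it suffices to prove that for each pair (U,M) ∈ Q_3, only an ε-fraction of compatible partitions can be bad")] -/
theorem card_OmegaR_filter_le_of_fibre (t : ℕ) (X : Finset (Finset (Fin n))) (Y : Finset (Finset (Sym2 (Fin n))))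
    (B : (Fin n → Lbl m) → Finset (Sym2 (Fin n)) → Prop) [∀ lab H, Decidable (B lab H)] {ε : ℝ}
    (hfib : ∀ (U : Finset (Fin n)) (M : Finset (Sym2 (Fin n))),
      (((Omega n m k t 3).filter fun ω => (ω.2.1 = U ∧ ω.2.2 = M) ∧ B ω.1 (ω.2.2.filter (IsCD ω.1))).card : ℝ) ≤
        ε * ((Omega n m k t 3).filter fun ω => ω.2.1 = U ∧ ω.2.2 = M).card) :
    (((OmegaR n m k t 3 X Y).filter fun ω => B ω.1 (ω.2.2.filter (IsCD ω.1))).card : ℝ) ≤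
      ε * (OmegaR n m k t 3 X Y).card := by
  classical
  have hmaps : ∀ (S : Finset ((Fin n → Lbl m) × Finset (Fin n) × Finset (Sym2 (Fin n)))), S ⊆ OmegaR n m k t 3 X Y →
      Set.MapsTo (fun ω : (Fin n → Lbl m) × Finset (Fin n) × Finset (Sym2 (Fin n)) => (ω.2.1, ω.2.2)) ↑S ↑(X ×ˢ Y) := by
    intro S hS ω hω
    have := hS (Finset.mem_coe.1 hω)
    rw [OmegaR, mem_filter] at this
    rw [Finset.mem_coe, mem_product]
    exact this.2
  rw [card_eq_sum_card_fiberwise (hmaps _ (filter_subset _ _)),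
    card_eq_sum_card_fiberwise (hmaps _ Subset.rfl)]
  push_cast
  rw [mul_sum]
  refine sum_le_sum fun p hp => ?_
  obtain ⟨hpX, hpY⟩ := mem_product.1 hp
  have h := hfib p.1 p.2
  have e1 : ((OmegaR n m k t 3 X Y).filter fun ω => B ω.1 (ω.2.2.filter (IsCD ω.1))).filter
      (fun ω => (ω.2.1, ω.2.2) = p) =
      (Omega n m k t 3).filter fun ω => (ω.2.1 = p.1 ∧ ω.2.2 = p.2) ∧ B ω.1 (ω.2.2.filter (IsCD ω.1)) := by
    ext ω
    simp only [mem_filter, OmegaR, Prod.ext_iff]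
    constructor
    · rintro ⟨⟨⟨hΩ, -, -⟩, hB⟩, h1, h2⟩; exact ⟨hΩ, ⟨h1, h2⟩, hB⟩
    · rintro ⟨hΩ, ⟨h1, h2⟩, hB⟩; exact ⟨⟨⟨hΩ, h1 ▸ hpX, h2 ▸ hpY⟩, hB⟩, h1, h2⟩
  have e2 : (OmegaR n m k t 3 X Y).filter (fun ω => (ω.2.1, ω.2.2) = p) =
      (Omega n m k t 3).filter fun ω => ω.2.1 = p.1 ∧ ω.2.2 = p.2 := by
    ext ω
    simp only [mem_filter, OmegaR, Prod.ext_iff]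
    constructor
    · rintro ⟨⟨hΩ, -, -⟩, h1, h2⟩; exact ⟨hΩ, h1, h2⟩
    · rintro ⟨hΩ, h1, h2⟩; exact ⟨⟨hΩ, h1 ▸ hpX, h2 ▸ hpY⟩, h1, h2⟩
  rw [e1, e2]
  exact h

/-! ### The decomposition `|Ω_3 ∩ R| ≤ good + small + bad` -/

/-- The outcomes split into good, small, and bad (= neither) ones. [cite: Rothvoss2017, §3.3 (PDF p. 9: "(GOOD + SMALL + BAD)")] -/
theorem card_OmegaR_le_good_add_small_add_bad (t : ℕ) (X : Finset (Finset (Fin n))) (Y : Finset (Finset (Sym2 (Fin n))))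
    (ε θ : ℝ) :
    (OmegaR n m k t 3 X Y).card ≤
      ((OmegaR n m k t 3 X Y).filter fun ω => GoodΩ X Y ω.1 t (ω.2.2.filter (IsCD ω.1)) ε).card +
      ((OmegaR n m k t 3 X Y).filter fun ω => SmallΩ X Y ω.1 t (ω.2.2.filter (IsCD ω.1)) θ).card +
      ((OmegaR n m k t 3 X Y).filter fun ω => ¬GoodΩ X Y ω.1 t (ω.2.2.filter (IsCD ω.1)) ε ∧
        ¬SmallΩ X Y ω.1 t (ω.2.2.filter (IsCD ω.1)) θ).card := by
  classical
  set S := OmegaR n m k t 3 X Y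
  have h1 := card_filter_add_card_filter_not (s := S) (fun ω => GoodΩ X Y ω.1 t (ω.2.2.filter (IsCD ω.1)) ε)
  have h2 : (S.filter fun ω => ¬GoodΩ X Y ω.1 t (ω.2.2.filter (IsCD ω.1)) ε).card ≤
      (S.filter fun ω => SmallΩ X Y ω.1 t (ω.2.2.filter (IsCD ω.1)) θ).card +
      (S.filter fun ω => ¬GoodΩ X Y ω.1 t (ω.2.2.filter (IsCD ω.1)) ε ∧
        ¬SmallΩ X Y ω.1 t (ω.2.2.filter (IsCD ω.1)) θ).card := by
    refine (card_le_card fun ω hω => ?_).trans (card_union_le _ _)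
    rw [mem_filter] at hω
    rw [mem_union, mem_filter, mem_filter]
    by_cases hs : SmallΩ X Y ω.1 t (ω.2.2.filter (IsCD ω.1)) θ
    · exact Or.inl ⟨hω.1, hs⟩
    · exact Or.inr ⟨hω.1, hω.2, hs⟩
  omega

/-! ### A constant size for `kext`, and the numerical constant -/

/-- The number of `k`-matchings between `C` and `D` containing a given `3`-matching is one positive
constant over all partitions and `3`-matchings (by symmetry). [folklore] -/
theorem exists_card_kext_const (hk : 3 ≤ k) (m : ℕ) :
    ∃ c₁ : ℕ, 0 < c₁ ∧ ∀ lab ∈ partitions (3 * m * (k - 3) + 2 * k) m k, ∀ H ∈ cdMatchings lab 3,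
      (kext lab k H).card = c₁ := by
  classical
  obtain ⟨lab₀, hlab₀⟩ := partitions_nonempty m k
  obtain ⟨H₀, hH₀⟩ := cdMatchings_nonempty hlab₀ hk
  refine ⟨(kext lab₀ k H₀).card, ?_, fun lab hlab H hH => card_kext_eq hlab hH hlab₀ hH₀ hk⟩
  have hsum := sum_card_kext lab₀ k 3
  have hconst : ∑ H ∈ cdMatchings lab₀ 3, (kext lab₀ k H).card =
      (cdMatchings lab₀ 3).card * (kext lab₀ k H₀).card :=
    sum_const_nat fun H hH => card_kext_eq hlab₀ hH hlab₀ hH₀ hk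
  have hpos : 0 < (cdMatchings lab₀ k).card * k.choose 3 :=
    Nat.mul_pos (cdMatchings_nonempty hlab₀ le_rfl).card_pos (Nat.choose_pos hk)
  rw [← hsum, hconst] at hpos
  exact Nat.pos_of_ne_zero fun h0 => by rw [h0, mul_zero] at hpos; exact lt_irrefl _ hpos

/-- `binom(k,3) ≥ (k-2)³/6`. [folklore] -/
theorem sub_two_pow_three_le_choose (k : ℕ) : ((k : ℝ) - 2) ^ 3 / 6 ≤ (k.choose 3 : ℝ) := by
  rcases lt_or_ge k 2 with hk | hk
  · have hneg : (k : ℝ) - 2 ≤ 0 := by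
      have : (k : ℝ) < 2 := by exact_mod_cast hk
      linarith
    have h3 : ((k : ℝ) - 2) ^ 3 ≤ 0 := Odd.pow_nonpos ⟨1, by norm_num⟩ hneg
    have h0 : (0 : ℝ) ≤ (k.choose 3 : ℝ) := Nat.cast_nonneg _
    linarith
  have h := Nat.pow_le_choose (α := ℝ) 3 k
  have e1 : ((k + 1 - 3 : ℕ) : ℝ) = (k : ℝ) - 2 := by
    have : ((k + 1 - 3 : ℕ) : ℝ) = ((k - 2 : ℕ) : ℝ) := by congr 1
    rw [this, Nat.cast_sub hk]; norm_num
  have e2 : ((Nat.factorial 3 : ℕ) : ℝ) = 6 := by norm_num [Nat.factorial]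
  rw [e1, e2] at h
  exact h

/-- The numerical constant of the good part: `(8/7)·(9/8)³·(3k-8)/binom(k,3) ≤ 400/k²` for `k ≥ 10`
(Rothvoß: "`≤ 200/k²`" with his constants). [cite: Rothvoss2017, §3.4 (PDF p. 10)] -/
theorem good_coeff_le (hk : 10 ≤ k) :
    (8 / 7 : ℝ) * ((1 + 1 / 8) ^ 3 * ((3 * (k - 3) + 1 : ℕ) / (k.choose 3 : ℝ))) ≤ 400 / (k : ℝ) ^ 2 := by
  have hk' : (10 : ℝ) ≤ k := by exact_mod_cast hk
  have hC := sub_two_pow_three_le_choose k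
  have hCpos : (0 : ℝ) < (k.choose 3 : ℝ) := by exact_mod_cast Nat.choose_pos (by omega)
  have hg : ((3 * (k - 3) + 1 : ℕ) : ℝ) = 3 * (k : ℝ) - 8 := by
    have : ((k - 3 : ℕ) : ℝ) = (k : ℝ) - 3 := by rw [Nat.cast_sub (by omega)]; norm_num
    push_cast [this]; ring
  rw [hg]
  have hk2 : (0 : ℝ) < ((k : ℝ) - 2) ^ 3 := by
    have : (0 : ℝ) < (k : ℝ) - 2 := by linarith
    positivity
  have hgC : (3 * (k : ℝ) - 8) / (k.choose 3 : ℝ) ≤ 6 * (3 * (k : ℝ) - 8) / ((k : ℝ) - 2) ^ 3 := by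
    rw [div_le_div_iff₀ hCpos hk2]
    have h38 : (0 : ℝ) ≤ 3 * (k : ℝ) - 8 := by linarith
    nlinarith [mul_le_mul_of_nonneg_left hC h38]
  have hk0 : (0 : ℝ) < (k : ℝ) ^ 2 := by positivity
  calc (8 / 7 : ℝ) * ((1 + 1 / 8) ^ 3 * ((3 * (k : ℝ) - 8) / (k.choose 3 : ℝ)))
      ≤ (8 / 7 : ℝ) * ((1 + 1 / 8) ^ 3 * (6 * (3 * (k : ℝ) - 8) / ((k : ℝ) - 2) ^ 3)) := by
        gcongr
    _ ≤ 400 / (k : ℝ) ^ 2 := by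
        rw [show (8 / 7 : ℝ) * ((1 + 1 / 8) ^ 3 * (6 * (3 * (k : ℝ) - 8) / ((k : ℝ) - 2) ^ 3)) =
            ((8 / 7 : ℝ) * (1 + 1 / 8) ^ 3 * (6 * (3 * (k : ℝ) - 8))) / ((k : ℝ) - 2) ^ 3 by ring]
        rw [div_le_div_iff₀ hk2 hk0]
        have h8 : (0 : ℝ) ≤ (k : ℝ) - 10 := by linarith
        nlinarith [mul_nonneg h8 h8, mul_nonneg (mul_nonneg h8 h8) h8, sq_nonneg ((k : ℝ) - 10)]

/-! ### Lemma 7 from the bad-fibre bound -/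

/-- The real arithmetic of `(*)`: `R₃ ≤ G + S + B`, `G·O_k ≤ K·R_k·O₃`, `S ≤ θ O₃`, `B ≤ R₃/8`,
`(8/7)K ≤ C` give `R₃/O₃ ≤ C·R_k/O_k + (8/7)θ`. [folklore] -/
theorem ratio_le_of_parts {R₃ G S B Rk O₃ Ok K C θ : ℝ} (hO₃ : 0 < O₃) (hOk : 0 < Ok)
    (hRk : 0 ≤ Rk) (hdec : R₃ ≤ G + S + B) (hgood : G * Ok ≤ K * Rk * O₃) (hsmall : S ≤ θ * O₃)
    (hbad : B ≤ 1 / 8 * R₃) (hcoef : 8 / 7 * K ≤ C) :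
    R₃ / O₃ ≤ C * (Rk / Ok) + 8 / 7 * θ := by
  have hGle : G ≤ K * (Rk / Ok) * O₃ := by
    have h1 : G ≤ K * Rk * O₃ / Ok := (le_div_iff₀ hOk).2 hgood
    calc G ≤ K * Rk * O₃ / Ok := h1
      _ = K * (Rk / Ok) * O₃ := by ring
  have hX : (0 : ℝ) ≤ Rk / Ok * O₃ := by positivity
  have h1 : R₃ ≤ 8 / 7 * G + 8 / 7 * θ * O₃ := by linarith
  have h2 : (8 / 7 : ℝ) * G ≤ C * (Rk / Ok) * O₃ :=
    calc (8 / 7 : ℝ) * G ≤ 8 / 7 * (K * (Rk / Ok) * O₃) := by linarith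
      _ = (8 / 7 * K) * (Rk / Ok * O₃) := by ring
      _ ≤ C * (Rk / Ok * O₃) := mul_le_mul_of_nonneg_right hcoef hX
      _ = C * (Rk / Ok) * O₃ := by ring
  rw [div_le_iff₀ hO₃]
  linarith

/-- **Rothvoß's Lemma 7 in sample-space form, from Lemma 13.** For odd `k ≥ 11`, odd `m ≥ 1`,
`θ ≥ 0` and a rectangle `X × Y` avoiding `|δ(U) ∩ M| = 1`: if in every `(U, M)`-fibre of `Ω_3` at
most `1/8` of the outcomes are BAD (neither GOOD for `ε = 1/8` nor SMALL for `θ`), then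
`|Ω_3 ∩ R|/|Ω_3| ≤ (400/k²)·|Ω_k ∩ R|/|Ω_k| + (8/7)·θ`; stated for `n = 3m(k-3)+2k`,
`t = (m+1)(k-3)/2 + 3` given as equations.
[cite: Rothvoss2017, Lemma 7 (PDF p. 8) via §3.3 `(*)` (PDF p. 9) and Lemma 13 (PDF p. 11)] -/
theorem lemma7_of_bad_fibre_bound {k m n t : ℕ} (hk : 10 ≤ k) (hko : k % 2 = 1) (hm1 : 1 ≤ m)
    (hmo : m % 2 = 1) (hn : n = 3 * m * (k - 3) + 2 * k) (ht : t = (m + 1) / 2 * (k - 3) + 3)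
    {θ : ℝ} (hθ : 0 ≤ θ) (X : Finset (Finset (Fin n))) (Y : Finset (Finset (Sym2 (Fin n))))
    (havoid : ∀ U ∈ X, ∀ M ∈ Y, (M.filter (Crosses U)).card ≠ 1)
    (hfib : ∀ (U : Finset (Fin n)) (M : Finset (Sym2 (Fin n))),
      (((Omega n m k t 3).filter fun ω => (ω.2.1 = U ∧ ω.2.2 = M) ∧
          (¬GoodΩ X Y ω.1 t (ω.2.2.filter (IsCD ω.1)) (1 / 8) ∧
            ¬SmallΩ X Y ω.1 t (ω.2.2.filter (IsCD ω.1)) θ)).card : ℝ) ≤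
        1 / 8 * ((Omega n m k t 3).filter fun ω => ω.2.1 = U ∧ ω.2.2 = M).card) :
    ((OmegaR n m k t 3 X Y).card : ℝ) / (Omega n m k t 3).card ≤
      400 / (k : ℝ) ^ 2 * (((OmegaR n m k t k X Y).card : ℝ) / (Omega n m k t k).card) +
        8 / 7 * θ := by
  classical
  subst hn
  obtain ⟨c₁, hc₁pos, hc₁⟩ := exists_card_kext_const (k := k) (by omega) m
  have hO3 : (0 : ℝ) < (Omega (3 * m * (k - 3) + 2 * k) m k t 3).card := by
    rw [ht]
    exact_mod_cast (omega_nonempty_params (r := 3) (by omega) hko hm1 (Or.inl rfl)).card_pos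
  have hOk : (0 : ℝ) < (Omega (3 * m * (k - 3) + 2 * k) m k t k).card := by
    rw [ht]
    exact_mod_cast (omega_nonempty_params (r := k) (by omega) hko hm1 (Or.inr rfl)).card_pos
  have hdec : ((OmegaR (3 * m * (k - 3) + 2 * k) m k t 3 X Y).card : ℝ) ≤
      (((OmegaR (3 * m * (k - 3) + 2 * k) m k t 3 X Y).filter fun ω =>
          GoodΩ X Y ω.1 t (ω.2.2.filter (IsCD ω.1)) (1 / 8)).card : ℝ) +
      (((OmegaR (3 * m * (k - 3) + 2 * k) m k t 3 X Y).filter fun ω =>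
          SmallΩ X Y ω.1 t (ω.2.2.filter (IsCD ω.1)) θ).card : ℝ) +
      (((OmegaR (3 * m * (k - 3) + 2 * k) m k t 3 X Y).filter fun ω =>
          ¬GoodΩ X Y ω.1 t (ω.2.2.filter (IsCD ω.1)) (1 / 8) ∧
            ¬SmallΩ X Y ω.1 t (ω.2.2.filter (IsCD ω.1)) θ).card : ℝ) := by
    exact_mod_cast card_OmegaR_le_good_add_small_add_bad (m := m) (k := k) t X Y (1 / 8 : ℝ) θ
  have hgood := card_OmegaR_good_mul_le (X := X) (Y := Y) (ε := (1 / 8 : ℝ))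
    (by omega : 4 ≤ k) hmo (by norm_num) ht havoid hc₁pos hc₁
  have hsmall := card_OmegaR_small_le (m := m) (k := k) t X Y hθ
  have hbad := card_OmegaR_filter_le_of_fibre (m := m) (k := k) t X Y
    (fun lab H => ¬GoodΩ X Y lab t H (1 / 8) ∧ ¬SmallΩ X Y lab t H θ) hfib
  exact ratio_le_of_parts hO3 hOk (Nat.cast_nonneg _) hdec hgood hsmall hbad (good_coeff_le hk)

/-- `(8/7)·2^{-δm} ≤ 2^{-(δ/2)m}` once `δ m ≥ 2`. [folklore] -/
theorem eight_sevenths_mul_rpow_le {δ : ℝ} {m : ℕ} (h : 2 ≤ δ * m) :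
    (8 / 7 : ℝ) * (2 : ℝ) ^ (-(δ * m)) ≤ (2 : ℝ) ^ (-(δ / 2 * m)) := by
  have hsplit : (2 : ℝ) ^ (-(δ * m)) = (2 : ℝ) ^ (-(δ / 2 * m)) * (2 : ℝ) ^ (-(δ / 2 * m)) := by
    rw [← Real.rpow_add (by norm_num : (0 : ℝ) < 2)]; congr 1; ring
  have hhalf : (2 : ℝ) ^ (-(δ / 2 * m)) ≤ 1 / 2 := by
    have : (2 : ℝ) ^ (-(δ / 2 * m)) ≤ (2 : ℝ) ^ (-1 : ℝ) :=
      Real.rpow_le_rpow_of_exponent_le (by norm_num) (by linarith)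
    rwa [Real.rpow_neg_one, ← one_div] at this
  have hpos : (0 : ℝ) < (2 : ℝ) ^ (-(δ / 2 * m)) := by positivity
  rw [hsplit]
  nlinarith

/-- **`Rothvoss2017_tsp` from the bad-fibre bound (Rothvoß's Lemma 13).** If for some odd
`k ≥ 401`, `δ > 0` and all large odd `m`, every rectangle avoiding `|δ(U) ∩ M| = 1` and every
`(U, M)`-fibre of `Ω_3` has at most `1/8` BAD outcomes (not GOOD for `ε = 1/8`, not SMALL for
`θ = 2^{-δm}`), then `xc(P_TSP(n)) ≥ 2^{Ω(n)}`.
[cite: Rothvoss2017, Lemma 13 ⇒ Lemma 7 ⇒ Theorem 4 ⇒ Corollary 2 (PDF pp. 4–11)] -/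
theorem rothvoss2017_tsp_of_bad_fibre_bound {k : ℕ} (hk : 401 ≤ k) (hko : k % 2 = 1) {δ : ℝ}
    (hδ : 0 < δ) {m₀ : ℕ}
    (hL13 : ∀ m : ℕ, m₀ ≤ m → m % 2 = 1 →
      ∀ (X : Finset (Finset (Fin (3 * m * (k - 3) + 2 * k))))
        (Y : Finset (Finset (Sym2 (Fin (3 * m * (k - 3) + 2 * k))))),
        (∀ U ∈ X, ∀ M ∈ Y, (M.filter (Crosses U)).card ≠ 1) →
        ∀ (U : Finset (Fin (3 * m * (k - 3) + 2 * k)))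
          (M : Finset (Sym2 (Fin (3 * m * (k - 3) + 2 * k)))),
        (((Omega (3 * m * (k - 3) + 2 * k) m k ((m + 1) / 2 * (k - 3) + 3) 3).filter fun ω =>
            (ω.2.1 = U ∧ ω.2.2 = M) ∧
              (¬GoodΩ X Y ω.1 ((m + 1) / 2 * (k - 3) + 3) (ω.2.2.filter (IsCD ω.1)) (1 / 8) ∧
                ¬SmallΩ X Y ω.1 ((m + 1) / 2 * (k - 3) + 3) (ω.2.2.filter (IsCD ω.1))
                  ((2 : ℝ) ^ (-(δ * m))))).card : ℝ) ≤
          1 / 8 * ((Omega (3 * m * (k - 3) + 2 * k) m k ((m + 1) / 2 * (k - 3) + 3) 3).filter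
            fun ω => ω.2.1 = U ∧ ω.2.2 = M).card) :
    Rothvoss2017_tsp := by
  have hδ2 : 0 < δ / 2 := half_pos hδ
  refine rothvoss2017_tsp_of_sampler_bound hk hko hδ2 (m₀ := max m₀ (Nat.ceil (2 / δ)))
    fun m hm hmo X Y havoid => ?_
  have hm₀ : m₀ ≤ m := le_trans (le_max_left _ _) hm
  have hm2 : 2 ≤ δ * m := by
    have h1 : (Nat.ceil (2 / δ) : ℝ) ≤ m := by exact_mod_cast le_trans (le_max_right _ _) hm
    have h2 : 2 / δ ≤ m := (Nat.le_ceil _).trans h1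
    rw [div_le_iff₀ hδ] at h2
    linarith
  have hm1 : 1 ≤ m := by omega
  have hθ : (0 : ℝ) ≤ (2 : ℝ) ^ (-(δ * m)) := by positivity
  have h7 := lemma7_of_bad_fibre_bound (by omega) hko hm1 hmo rfl rfl hθ X Y havoid
    (hL13 m hm₀ hmo X Y havoid)
  exact h7.trans (by nlinarith [eight_sevenths_mul_rpow_le hm2])

end Literature.Barriers.PneNP
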